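import Summits.QuantumFields.BalabanUV.Beta.EriceRemainderEnclosureHistoryAutonomyComparisonAffineProfile

/-!
# EriceRemainderEnclosureHistoryAutonomyComparisonLoadBudget — (E64i) THE JOINT LOAD BUDGET: along every box solution of an isotone memory with floor dominated
# by a profile `L ≥ 0`, the loads `x_k = k·L_k·h_k³∕2` satisfy, at EVERY scale `j ≥ 1`, **`Σ_{k≤j} x_k·√(k∕j) + Σ_{k>j} x_k·(j∕k) ≤ √2∕2`** — the trajectory-free
# constraint coupling neighbouring loads under which (E64e)'s slack system is to be certified (route (C) of `HOME/…/g57/e64/README.md`)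

Cell `pub-balaban`, β-function sub-cell, BINDER row D4 «RemainderConst leaves for Bałaban's split» (`HOME/BINDER-OWNERS.md`; owner lineage `b2b-balaban-beta-an4`;
this file by co-owner #2 lineage `b2b-balaban-beta-d4-p2`, generation 57), β-FLOW TEAM duty (1), FREEZE (0) honoured (def-free; (E58b)'s `mul_invSq_add_le` ∕
`mul_sqrt_le_read` ∕ `mul_read_le_invSq_of_dom`, (E48a)'s `strictAnti_of_memFlow` BY NAME; nothing restated).

HONEST FRAMING (page 1, verbatim and binding).  *"Discharging BetaPertH makes Bałaban's UV stability UNCONDITIONAL — a real constructive-QFT result; it is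
NOT the continuum limit and NOT the Clay problem."*  THIS FILE DISCHARGES NOTHING OF THE KIND.  Elementary real analysis about ABSTRACT functionals on a box
]0,γ]^ℕ with displayed floors, profiles and signs — hypotheses of a census, not facts; the form, signs, ages and moments of Bałaban's (1.22) limit functional
are NOT PRINTED ([I] p. 298; GAPS G-t4-U2-1∕-2) and NOT asserted.  Row D4 class UNCHANGED (critical-path width 0; instance 0∕1; D4 DISCHARGE NO DATE).  HONEST
DEPENDENCY: continuum YM on T⁴ ⇐ BetaPertH ∧ nine spine estimates (0/9 proved); BetaPertH ⇐ (D1) ∧ (D4) ∧ CAP+tail; G-an2-4 gates asym, D1 and NE2/3/4.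

THE POINT (census sense (α); the COMPARISON column, conjecture (E58′)).  (E64e) reduces comparison for ANY age set to a certificate for the slack system
with loads `x̂_j`; (E64b)∕(E64f) certify towers using only `x_j ≤ √2∕2` per age, which is why they need ratios `30` ∕ `14` and margins `4^{−n}`.  The loads of a
REAL trajectory are jointly constrained: the single inequality `j·Σ_k L_k·h_{j+k} ≤ 1∕h_j²` at scale `j` ((E58b)), read with `h_{j+k} ≥ √(j∕(j+k))·h_j`,
`h_{j+k} ≥ √(k∕(k+j))·h_k` and the level concavity `k·h_k² ≤ j·h_j²` (`k ≤ j`), bounds every younger load with weight `√(k∕j)` and every older load with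
weight `j∕k` (§1 termwise, §2 `load_budget`).  Numerically (README `bilevel.py`, `talltowers.py`) the budgeted slack system has value `< 1` on every age
set searched (dense `1..8`: `0.80`; towers at ratio `2–10` up to `9` ages: `≤ 0.997`); a proof of «always `≤ 1`» would settle (E58′) via (E64e).  NOT CLAIMED:
that; anything printed.

WHAT IS PROVED ([folklore]; 0 `def`, 0 sorry).  §1 `load_le_read_young`, `load_le_read_old`.  §2 **`load_budget`**.
-/
noncomputable section
open Finset Set

namespace Summit.QuantumFields.BalabanUV.Beta.EriceRemainderEnclosureHistoryAutonomyComparisonLoadBudget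

open Literature.MathematicalPhysics.QuantumFieldTheory.Balaban1983to89
open Literature.MathematicalPhysics.QuantumFieldTheory.Balaban1983to89.T4BetaStationary
open Literature.MathematicalPhysics.QuantumFieldTheory.Balaban1983to89.T4BetaFlowWellPosed
open Summit.QuantumFields.BalabanUV.Beta.EriceRemainderEnclosureHistoryAutonomyOrder (strictAnti_of_memFlow)
open Summit.QuantumFields.BalabanUV.Beta.EriceRemainderEnclosureHistoryAutonomyComparisonAffineProfile
  (mul_invSq_add_le mul_sqrt_le_read mul_read_le_invSq_of_dom)

variable {B : (ℕ → ℝ) → ℝ} {γ b y : ℝ} {L : ℕ → ℝ} {K : ℕ} {h : ℕ → ℝ}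

/-! ## §1 Termwise: each load against the read at scale `j` -/

/-- A YOUNGER age `k ≤ j` (`j ≥ 1`): `k·h_k³·√(k∕j) ≤ √2·j·h_j²·h_{j+k}` along every box solution of an isotone memory with floor — from level concavity
(`k·h_k² ≤ j·h_j²`) and the read bound `h_{j+k} ≥ √(j∕(j+k))·h_j ≥ h_j∕√2`. [folklore] -/
theorem load_le_read_young (hmono : ∀ u v : ℕ → ℝ, SeqBox γ u → SeqBox γ v → (∀ j, u j ≤ v j) → B u ≤ B v) (hb : 0 < b)
    (hlo : ∀ u, SeqBox γ u → b ≤ B u) (hy : 0 < y) (hh : SeqBox γ h) (hf : MemFlow B y h) {j k : ℕ} (hj : 1 ≤ j) (hkj : k ≤ j) :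
    (k : ℝ) * h k ^ 3 * Real.sqrt ((k : ℝ) / j) ≤ Real.sqrt 2 * ((j : ℝ) * h j ^ 2) * h (j + k) := by
  have hjr : (0 : ℝ) < j := by exact_mod_cast hj
  have hkr : (0 : ℝ) ≤ k := Nat.cast_nonneg k
  have hhj := (hh j).1
  have hhk := (hh k).1
  have hhjk := (hh (j + k)).1
  -- the read bound: h (j+k) ≥ √(j/(j+k))·h j ≥ √(1/2)·h j
  have hread := mul_sqrt_le_read hmono hb hlo hy hh hf j k
  have hhalf : Real.sqrt (1 / 2) ≤ Real.sqrt ((j : ℝ) / ((j : ℝ) + k)) := by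
    apply Real.sqrt_le_sqrt
    rw [div_le_div_iff₀ (by norm_num) (by positivity)]
    have : (k : ℝ) ≤ j := by exact_mod_cast hkj
    linarith
  have hs : Real.sqrt 2 * Real.sqrt (1 / 2) = 1 := by
    rw [← Real.sqrt_mul (by norm_num)]; norm_num
  have hR : (j : ℝ) * h j ^ 3 ≤ Real.sqrt 2 * ((j : ℝ) * h j ^ 2) * h (j + k) := by
    have h1 : Real.sqrt (1 / 2) * h j ≤ h (j + k) := (mul_le_mul_of_nonneg_right hhalf hhj.le).trans hread
    have := mul_le_mul_of_nonneg_left h1 (by positivity : (0 : ℝ) ≤ Real.sqrt 2 * ((j : ℝ) * h j ^ 2))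
    calc (j : ℝ) * h j ^ 3 = Real.sqrt 2 * Real.sqrt (1 / 2) * ((j : ℝ) * h j ^ 3) := by rw [hs, one_mul]
      _ = Real.sqrt 2 * ((j : ℝ) * h j ^ 2) * (Real.sqrt (1 / 2) * h j) := by ring
      _ ≤ Real.sqrt 2 * ((j : ℝ) * h j ^ 2) * h (j + k) := this
  -- the level concavity: k·h_k² ≤ j·h_j²
  have hconc : (k : ℝ) * h k ^ 2 ≤ (j : ℝ) * h j ^ 2 := by
    have hc := mul_invSq_add_le hmono hb hlo hy hh hf k (j - k)
    have e : k + (j - k) = j := by omega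
    have e' : (k : ℝ) + ((j - k : ℕ) : ℝ) = j := by exact_mod_cast e
    rw [e, e'] at hc
    have := mul_le_mul_of_nonneg_right hc (by positivity : (0 : ℝ) ≤ h j ^ 2 * h k ^ 2)
    have e1 : (k : ℝ) * (1 / h j ^ 2) * (h j ^ 2 * h k ^ 2) = (k : ℝ) * h k ^ 2 := by field_simp
    have e2 : (j : ℝ) * (1 / h k ^ 2) * (h j ^ 2 * h k ^ 2) = (j : ℝ) * h j ^ 2 := by field_simp
    rw [e1, e2] at this; exact this
  -- hence (k·h_k³·√(k/j))² = (k h_k²)³ / j ≤ (j h_j²)³ / j = (j·h_j³)²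
  have hL : (k : ℝ) * h k ^ 3 * Real.sqrt ((k : ℝ) / j) ≤ (j : ℝ) * h j ^ 3 := by
    have hsq : ((k : ℝ) * h k ^ 3 * Real.sqrt ((k : ℝ) / j)) ^ 2 ≤ ((j : ℝ) * h j ^ 3) ^ 2 := by
      have hkj3 : ((k : ℝ) * h k ^ 2) ^ 3 ≤ ((j : ℝ) * h j ^ 2) ^ 3 := pow_le_pow_left₀ (by positivity) hconc 3
      have e1 : ((k : ℝ) * h k ^ 3 * Real.sqrt ((k : ℝ) / j)) ^ 2 = ((k : ℝ) * h k ^ 2) ^ 3 / j := by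
        rw [mul_pow, Real.sq_sqrt (by positivity)]; field_simp
      have e2 : ((j : ℝ) * h j ^ 3) ^ 2 = ((j : ℝ) * h j ^ 2) ^ 3 / j := by field_simp
      rw [e1, e2]
      exact div_le_div_of_nonneg_right hkj3 hjr.le
    exact (pow_le_pow_iff_left₀ (by positivity) (by positivity) two_ne_zero).mp hsq
  exact hL.trans hR

/-- An OLDER age `k > j`: `j·h_k³ ≤ √2·j·h_j²·h_{j+k}` — from `h_k ≤ h_j` and `h_{j+k} ≥ √(k∕(k+j))·h_k ≥ h_k∕√2`. [folklore] -/
theorem load_le_read_old (hmono : ∀ u v : ℕ → ℝ, SeqBox γ u → SeqBox γ v → (∀ j, u j ≤ v j) → B u ≤ B v) (hb : 0 < b)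
    (hlo : ∀ u, SeqBox γ u → b ≤ B u) (hy : 0 < y) (hh : SeqBox γ h) (hf : MemFlow B y h) {j k : ℕ} (hjk : j < k) :
    (j : ℝ) * h k ^ 3 ≤ Real.sqrt 2 * ((j : ℝ) * h j ^ 2) * h (j + k) := by
  have hjr : (0 : ℝ) ≤ j := Nat.cast_nonneg j
  have hkr : (0 : ℝ) < k := by exact_mod_cast (Nat.zero_le j).trans_lt hjk
  have hhj := (hh j).1
  have hhk := (hh k).1
  have hanti := (strictAnti_of_memFlow hb hlo hh hf).antitone
  have hkj : h k ≤ h j := hanti hjk.le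
  have hread := mul_sqrt_le_read hmono hb hlo hy hh hf k j
  rw [show k + j = j + k by omega] at hread
  have hhalf : Real.sqrt (1 / 2) ≤ Real.sqrt ((k : ℝ) / ((k : ℝ) + j)) := by
    apply Real.sqrt_le_sqrt
    rw [div_le_div_iff₀ (by norm_num) (by positivity)]
    have : (j : ℝ) ≤ k := by exact_mod_cast hjk.le
    linarith
  have hs : Real.sqrt 2 * Real.sqrt (1 / 2) = 1 := by
    rw [← Real.sqrt_mul (by norm_num)]; norm_num
  have h1 : Real.sqrt (1 / 2) * h k ≤ h (j + k) := (mul_le_mul_of_nonneg_right hhalf hhk.le).trans hread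
  have h2 : h k ^ 2 ≤ h j ^ 2 := pow_le_pow_left₀ hhk.le hkj 2
  calc (j : ℝ) * h k ^ 3 = Real.sqrt 2 * Real.sqrt (1 / 2) * ((j : ℝ) * h k ^ 2 * h k) := by rw [hs, one_mul]; ring
    _ = Real.sqrt 2 * ((j : ℝ) * h k ^ 2) * (Real.sqrt (1 / 2) * h k) := by ring
    _ ≤ Real.sqrt 2 * ((j : ℝ) * h k ^ 2) * h (j + k) := mul_le_mul_of_nonneg_left h1 (by positivity)
    _ ≤ Real.sqrt 2 * ((j : ℝ) * h j ^ 2) * h (j + k) :=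
        mul_le_mul_of_nonneg_right (mul_le_mul_of_nonneg_left (mul_le_mul_of_nonneg_left h2 hjr) (Real.sqrt_nonneg _)) (hh (j + k)).1.le

/-! ## §2 THE JOINT LOAD BUDGET at every scale -/

/-- **THE JOINT LOAD BUDGET.**  `B` isotone with floor `b > 0`, DOMINATED by the profile `L ≥ 0` (`Σ_{k<K} L_k·u_k ≤ B u`); along every box solution `h` from
every pin `y > 0`, for every scale `j ≥ 1`: **`Σ_{k≤j} x_k·√(k∕j) + Σ_{k>j} x_k·(j∕k) ≤ √2∕2`** with the loads `x_k = k·L_k·h_k³∕2` — written as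
`Σ_{k<K} L_k·k·h_k³·W_j(k) ≤ √2`, `W_j(k) = √(k∕j)` for `k ≤ j` and `j∕k` for `k > j`.  From `j·Σ_k L_k·h_{j+k} ≤ 1∕h_j²` ((E58b) `mul_read_le_invSq_of_dom`) and
§1.  ONE age `k = j`: `x_j ≤ √2∕2` (the per-age bound of (E58b)+(E63c)); the budget couples neighbouring loads — the trajectory-free constraint under which
the slack system of (E64e) was searched (`HOME/…/g57/e64/README.md`, `bilevel.py`): no age set found with value `≥ 1`. [folklore] -/
theorem load_budget (hmono : ∀ u v : ℕ → ℝ, SeqBox γ u → SeqBox γ v → (∀ j, u j ≤ v j) → B u ≤ B v) (hL : ∀ k, 0 ≤ L k) (hb : 0 < b)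
    (hlo : ∀ u, SeqBox γ u → b ≤ B u) (hdom : ∀ u, SeqBox γ u → ∑ k ∈ range K, L k * u k ≤ B u) (hy : 0 < y) (hh : SeqBox γ h)
    (hf : MemFlow B y h) {j : ℕ} (hj : 1 ≤ j) :
    ∑ k ∈ range K, L k * k * h k ^ 3 * (if k ≤ j then Real.sqrt ((k : ℝ) / j) else (j : ℝ) / k) ≤ Real.sqrt 2 := by
  have hjr : (0 : ℝ) < j := by exact_mod_cast hj
  have hhj := (hh j).1
  have hread := mul_read_le_invSq_of_dom hmono hL hb hlo hdom hy hh hf j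
  have hterm : ∀ k ∈ range K, L k * k * h k ^ 3 * (if k ≤ j then Real.sqrt ((k : ℝ) / j) else (j : ℝ) / k) ≤
      Real.sqrt 2 * ((j : ℝ) * h j ^ 2) * (L k * h (j + k)) := by
    intro k _
    by_cases hkj : k ≤ j
    · rw [if_pos hkj]
      have := load_le_read_young hmono hb hlo hy hh hf hj hkj
      calc L k * k * h k ^ 3 * Real.sqrt ((k : ℝ) / j) = L k * ((k : ℝ) * h k ^ 3 * Real.sqrt ((k : ℝ) / j)) := by ring
        _ ≤ L k * (Real.sqrt 2 * ((j : ℝ) * h j ^ 2) * h (j + k)) := mul_le_mul_of_nonneg_left this (hL k)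
        _ = Real.sqrt 2 * ((j : ℝ) * h j ^ 2) * (L k * h (j + k)) := by ring
    · rw [if_neg hkj]
      have hjk : j < k := Nat.lt_of_not_le hkj
      have hkr : (0 : ℝ) < k := by exact_mod_cast (Nat.zero_le j).trans_lt hjk
      have := load_le_read_old hmono hb hlo hy hh hf hjk
      calc L k * k * h k ^ 3 * ((j : ℝ) / k) = L k * ((j : ℝ) * h k ^ 3) := by field_simp
        _ ≤ L k * (Real.sqrt 2 * ((j : ℝ) * h j ^ 2) * h (j + k)) := mul_le_mul_of_nonneg_left this (hL k)
        _ = Real.sqrt 2 * ((j : ℝ) * h j ^ 2) * (L k * h (j + k)) := by ring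
  calc ∑ k ∈ range K, L k * k * h k ^ 3 * (if k ≤ j then Real.sqrt ((k : ℝ) / j) else (j : ℝ) / k)
      ≤ ∑ k ∈ range K, Real.sqrt 2 * ((j : ℝ) * h j ^ 2) * (L k * h (j + k)) := sum_le_sum hterm
    _ = Real.sqrt 2 * h j ^ 2 * ((j : ℝ) * ∑ k ∈ range K, L k * h (j + k)) := by rw [mul_sum, mul_sum]; exact sum_congr rfl fun k _ => by ring
    _ ≤ Real.sqrt 2 * h j ^ 2 * (1 / h j ^ 2) := mul_le_mul_of_nonneg_left hread (by positivity)
    _ = Real.sqrt 2 := by field_simp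

end Summit.QuantumFields.BalabanUV.Beta.EriceRemainderEnclosureHistoryAutonomyComparisonLoadBudget

end
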